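import Literature.Computability.Complexity.KarpCliqueReduction

/-!
# The conflict-graph code of a CNF is computed in `FP`
(stub `stub_conflictGraphFn` of line `prg-image-exact-threshold-lift`)

Crux `Summit.PneNP.PneNP.Theses.PhaseTwins.PseudorandomTwinsAbove` (item stmt-PneNP-2721), step S4a.

For a CNF `φ` let `A := KarpClique.annot 0 φ` be its annotated literal occurrences (clause number,
binary variable, polarity; `KarpCliqueGadget.lean`). The CONFLICT graph of `φ` is the simple graph
on the positions of `A` in which `p ≠ q` are adjacent iff the two occurrences lie in the same clause
on different variables, or carry the same variable with opposite polarities (Karp's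
`3SAT → INDEPENDENT SET` graph, the complement inside clauses of Karp's CLIQUE graph
`KarpClique.graphOf A`). We show that some `f ∈ FP` maps the code `encodingCNF.encode φ` of EVERY
`φ : CNF ℕ` to the code (`encodingGraph`) of this graph, stated with `SimpleGraph.fromRel` of the
conflict relation.

The machine is that of `KarpCliqueReduction.lean`, which is generic in a one-bit emitter `E` run by
the clause-counting matrix loop `KarpClique.cmatFn E` over the tokenizer `CNFTok.tokFn`: we only
replace Karp's adjacency emitter `adjE` by the **conflict emitter**
`conflE := orFn (andFn clsEqT (notFn numEqT)) (andFn numEqT (notFn polEqT))` (value on descriptors: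
`conflE_desc`), copy the bridge `cmatM_adjE_eq`/`adjBits_graphOf` for the conflict Boolean `conflB`
(`cmatM_conflE_eq`, `adjBits_fromRel_confl`; the bit at `(p, q)` of the `fromRel` graph is
`conflB A[p] A[q]` since `conflB` is symmetric and irreflexive), and assemble
`conflFn := ⟨bin L, bits⟩ ∘ tokFn` (`redCoreB` without the clause count); on the code of `φ` the
annotated occurrences read off the tokens are `annot 0 φ` (`toks_encode`, `annFrom_tokensStr`).
Everything used is proved in the tree; no named facts.
-/

set_option linter.dupNamespace false -- `Summit.PneNP.PneNP.…`: summit = sub-problem (D-0017)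

noncomputable section

namespace Summit.PneNP.PneNP.Theorems

open Filter
open Literature.Computability.Complexity
open _root_.Computability

namespace ConflictGraphFn

open Literature.Computability.Complexity.Brick Literature.Computability.Complexity.OracleCompose
  Literature.Computability.Complexity.HashBricks Literature.Computability.Complexity.CNFTok
  Literature.Computability.Complexity.CliqueNP Literature.Computability.Complexity.KarpClique
  Polynomial

/-! ### The conflict Boolean and the conflict emitter -/

/-- **The conflict** of two annotated occurrences `x = ⟨i, σ⟩` (row) and `y = ⟨j, δ⟩` (column), as a
Boolean: same clause and different variables, or same variable and different polarities. -/
def conflB (x y : Ann) : Bool :=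
  (decide (x.1 = y.1) && !decide (x.2.1 = y.2.1)) ||
    (decide (x.2.1 = y.2.1) && !decide (x.2.2 = y.2.2))

/-- Truth of `conflB`. -/
theorem conflB_eq_true_iff (x y : Ann) :
    conflB x y = true ↔ (x.1 = y.1 ∧ x.2.1 ≠ y.2.1) ∨ (x.2.1 = y.2.1 ∧ x.2.2 ≠ y.2.2) := by
  unfold conflB
  by_cases h1 : x.1 = y.1 <;> by_cases h2 : x.2.1 = y.2.1 <;> by_cases h3 : x.2.2 = y.2.2 <;>
    simp [h1, h2, h3]

/-- The conflict is symmetric. -/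
theorem conflB_comm (x y : Ann) : conflB x y = conflB y x := by
  unfold conflB
  rw [show decide (x.1 = y.1) = decide (y.1 = x.1) from Bool.decide_congr eq_comm,
    show decide (x.2.1 = y.2.1) = decide (y.2.1 = x.2.1) from Bool.decide_congr eq_comm,
    show decide (x.2.2 = y.2.2) = decide (y.2.2 = x.2.2) from Bool.decide_congr eq_comm]

/-- The conflict is irreflexive. -/
theorem conflB_self (x : Ann) : conflB x x = false := by
  simp [conflB]

/-- **The conflict emitter** on a descriptor `⟨row record, ⟨1^{i}, ⟨column record, 1^{j}⟩⟩⟩` (token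
records with their clause numbers): the bit `[(i = j ∧ different variables) ∨ (same variable ∧
different polarities)]`. -/
def conflE : List Bool → List Bool :=
  orFn (andFn clsEqT (notFn numEqT)) (andFn numEqT (notFn polEqT))

/-- `conflE ∈ FP`. -/
theorem conflE_mem_FP : conflE ∈ FP :=
  orFn_mem_FP (andFn_mem_FP clsEqT_mem_FP (notFn_mem_FP numEqT_mem_FP))
    (andFn_mem_FP numEqT_mem_FP (notFn_mem_FP polEqT_mem_FP))

/-- `conflE` is one-bit. -/
theorem oneBit_conflE : OneBit conflE :=
  oneBit_orFn (oneBit_andFn oneBit_clsEqT (oneBit_notFn oneBit_numEqT))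
    (oneBit_andFn oneBit_numEqT (oneBit_notFn oneBit_polEqT))

/-- `conflE` emits at most one symbol. -/
theorem length_conflE_le (d : List Bool) : (conflE d).length ≤ 1 := by
  rw [oneBit_conflE.length_eq]

/-- **Value of the emitter**: the conflict `conflB` of the two annotated occurrences. -/
theorem conflE_desc (t t' : STok) (i j : ℕ) :
    conflE (desc (tokRec t) (ones i) (tokRec t') (ones j)) =
      [conflB (i, t.var, t.pol) (j, t'.var, t'.pol)] := by
  rw [conflE, orFn_apply (andFn_apply (clsEqT_desc t t' _ _) (notFn_apply (numEqT_desc t t' _ _)))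
    (andFn_apply (numEqT_desc t t' _ _) (notFn_apply (polEqT_desc t t' _ _))), conflB,
    show decide (ones j = ones i) = decide (i = j) from
      Bool.decide_congr (CliqueNP.ones_inj.trans eq_comm)]

/-! ### The emitted bits are the adjacency bits of the conflict graph -/

/-- **The bits emitted by the matrix loop**: row by row, the conflicts of the annotated
occurrences. -/
theorem cmatM_conflE_eq (T : List STok) :
    cmatM conflE (T.map tokRec) (T.map tokRec) [] =
      ((annFrom 0 T).map fun x => (annFrom 0 T).map (conflB x)).flatten := by
  have hrow : ∀ (t : STok) (p : ℕ), crowM conflE (tokRec t) (ones p) (T.map tokRec) [] =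
      (annFrom 0 T).map (conflB (p, t.var, t.pol)) := fun t p => by
    rw [show ([] : List Bool) = ones 0 from rfl,
      crowM_tokRec conflE (tokRec t) (ones p)
        (fun t' q => [conflB (p, t.var, t.pol) (q, t'.var, t'.pol)])
        (fun t' q => conflE_desc t t' p q) T 0,
      zipWith_clsSeq_eq_map (fun y => [conflB (p, t.var, t.pol) y]) 0 T, flatten_map_singleton]
  rw [show ([] : List Bool) = ones 0 from rfl, cmatM_tokRec conflE (T.map tokRec) _ hrow T 0,
    zipWith_clsSeq_eq_map (fun x => (annFrom 0 T).map (conflB x)) 0 T]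

/-- **Adjacency of the conflict graph** (`SimpleGraph.fromRel` of the conflict relation on
positions) is `conflB` of the two occurrences: `conflB` is symmetric and irreflexive. -/
theorem fromRel_confl_adj_iff (A : List Ann) (p q : Fin A.length) :
    (SimpleGraph.fromRel fun p q : Fin A.length =>
        (A[p].1 = A[q].1 ∧ A[p].2.1 ≠ A[q].2.1) ∨ (A[p].2.1 = A[q].2.1 ∧ A[p].2.2 ≠ A[q].2.2)).Adj
        p q ↔ conflB A[p] A[q] = true := by
  rw [SimpleGraph.fromRel_adj, conflB_eq_true_iff]
  constructor
  · rintro ⟨-, h | h⟩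
    · exact h
    · exact h.imp (fun h' => ⟨h'.1.symm, Ne.symm h'.2⟩) (fun h' => ⟨h'.1.symm, Ne.symm h'.2⟩)
  · intro h
    refine ⟨?_, Or.inl h⟩
    rintro rfl
    rcases h with ⟨-, h⟩ | ⟨-, h⟩ <;> exact h rfl

/-- **The adjacency bits of the conflict graph**, row by row. -/
theorem adjBits_fromRel_confl (A : List Ann) :
    adjBits A.length (SimpleGraph.fromRel fun p q : Fin A.length =>
        (A[p].1 = A[q].1 ∧ A[p].2.1 ≠ A[q].2.1) ∨ (A[p].2.1 = A[q].2.1 ∧ A[p].2.2 ≠ A[q].2.2)) =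
      (A.map fun x => A.map (conflB x)).flatten := by
  rw [adjBits, List.ofFn_mul]
  congr 1
  rw [← ofFn_getElem_map A (fun x => A.map (conflB x))]
  refine List.ofFn_inj.2 (funext fun i => ?_)
  rw [← ofFn_getElem_map A (conflB A[i])]
  refine List.ofFn_inj.2 (funext fun j => ?_)
  have hi : (⟨(i : ℕ) * A.length + j, flat_lt i j⟩ : Fin (A.length * A.length)).divNat = i :=
    Fin.ext (flat_div i j)
  have hj : (⟨(i : ℕ) * A.length + j, flat_lt i j⟩ : Fin (A.length * A.length)).modNat = j :=
    Fin.ext (flat_mod i j)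
  rw [hi, hj]
  exact (@Bool.decide_congr _ _ (Classical.propDecidable _) _ (fromRel_confl_adj_iff A i j)).trans
    Bool.decide_eq_true

/-! ### The conflict-graph function -/

/-- **The conflict-graph function** `z ↦ ⟨bin L, conflict bits⟩` of the token list read off `z`:
the tokenizer, then the token count in binary paired with the matrix loop of the conflict
emitter. -/
def conflFn : List Bool → List Bool :=
  fanoutFn (popCountFn ∘ nthF 6) (cmatFn conflE ∘ itemsInB) ∘ tokFn

/-- **`conflFn ∈ FP`.** -/
theorem conflFn_mem_FP : conflFn ∈ FP :=
  comp_mem_FP (fanoutFn_mem_FP (comp_mem_FP popCountFn_mem_FP (nthF_mem_FP 6))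
    (comp_mem_FP (cmatFn_mem_FP conflE_mem_FP length_conflE_le) itemsInB_mem_FP)) tokFn_mem_FP

/-- Value of `conflFn`: the two fields, the bits still as the matrix model. -/
theorem conflFn_eq (z : List Bool) :
    conflFn z = boolPair (encodeNat (toks z).length)
      (cmatM conflE ((toks z).map tokRec) ((toks z).map tokRec) []) := by
  rw [conflFn, Function.comp_apply, fanoutFn_apply, Function.comp_apply, nthF_six_tokFn,
    Function.comp_apply, itemsInB_tokFn, cmatFn_apply z _ (by simpa using length_toks_le z),
    popCountFn_apply, List.count_replicate_self]

/-- **Value of `conflFn` on EVERY string**: the code of the conflict graph of the annotated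
occurrences `A = annFrom 0 (toks z)` read off `z` (stated for a general name `A` of that list, so
that the dependent pair can be specialised without rewriting under the index proofs). -/
theorem conflFn_apply {z : List Bool} {A : List Ann} (hA : annFrom 0 (toks z) = A) :
    conflFn z = encodingGraph.encode ⟨A.length,
      SimpleGraph.fromRel fun p q : Fin A.length =>
        (A[p].1 = A[q].1 ∧ A[p].2.1 ≠ A[q].2.1) ∨ (A[p].2.1 = A[q].2.1 ∧ A[p].2.2 ≠ A[q].2.2)⟩ := by
  subst hA
  rw [encodingGraph_encode, encodingGraphFin_encode_eq]
  dsimp only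
  rw [adjBits_fromRel_confl, ← cmatM_conflE_eq, length_annFrom, conflFn_eq]

/-- **On the code of `φ`**: the code of the conflict graph on `annot 0 φ` (the annotated occurrences
read off the tokens of the code of `φ` are `annot 0 φ`: `toks_encode`, `annFrom_tokensStr`). -/
theorem conflFn_encode (φ : CNF ℕ) :
    conflFn (encodingCNF.encode φ) = encodingGraph.encode ⟨(annot 0 φ).length,
      SimpleGraph.fromRel fun p q : Fin (annot 0 φ).length =>
        ((annot 0 φ)[p].1 = (annot 0 φ)[q].1 ∧ (annot 0 φ)[p].2.1 ≠ (annot 0 φ)[q].2.1) ∨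
        ((annot 0 φ)[p].2.1 = (annot 0 φ)[q].2.1 ∧ (annot 0 φ)[p].2.2 ≠ (annot 0 φ)[q].2.2)⟩ :=
  conflFn_apply (by rw [toks_encode, annFrom_tokensStr])

end ConflictGraphFn

/-- **S4a — the conflict-graph code is computed in `FP`.** Some `f ∈ FP` maps the code of EVERY CNF
`φ` to the code (`encodingGraph`) of its CONFLICT graph on the annotated literal occurrences
`A := KarpClique.annot 0 φ` (clause number, binary variable, polarity): occurrences `p ≠ q` are
adjacent iff they lie in the same clause on different variables, or carry the same variable with
opposite polarities (Karp's `3SAT → INDEPENDENT SET` graph; the complement of `KarpClique.graphOf A`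
inside clauses). The witness is `ConflictGraphFn.conflFn` (`ConflictGraphFn.conflFn_encode`). -/
theorem stub_conflictGraphFn :
    ∃ f : List Bool → List Bool, f ∈ FP ∧ ∀ φ : CNF ℕ,
      f (encodingCNF.encode φ) = encodingGraph.encode ⟨(KarpClique.annot 0 φ).length,
        SimpleGraph.fromRel fun p q : Fin (KarpClique.annot 0 φ).length =>
          ((KarpClique.annot 0 φ)[p].1 = (KarpClique.annot 0 φ)[q].1 ∧
              (KarpClique.annot 0 φ)[p].2.1 ≠ (KarpClique.annot 0 φ)[q].2.1) ∨
          ((KarpClique.annot 0 φ)[p].2.1 = (KarpClique.annot 0 φ)[q].2.1 ∧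
              (KarpClique.annot 0 φ)[p].2.2 ≠ (KarpClique.annot 0 φ)[q].2.2)⟩ :=
  ⟨ConflictGraphFn.conflFn, ConflictGraphFn.conflFn_mem_FP, ConflictGraphFn.conflFn_encode⟩

end Summit.PneNP.PneNP.Theorems

end
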